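import Summits.BirchSwinnertonDyer.BirchSwinnertonDyer.Theorems.PrintCf2SplitBadTwoLocalTorsionCountAtV
import Summits.BirchSwinnertonDyer.BirchSwinnertonDyer.Theorems.PrintCf2SplitBadTwoF1Holds
import HarnessLib

/-!
# Crux `PrintCf2.SplitBadTwoRankOneOfFacts` (stmt-BirchSwinnertonDyer-20368), road α v10.3, S3c factor (F3):
# (LF.1) IN THE `∃ t` CLASS-FUNCTION SHAPE of -w4 g10's `hcounts_of_localTorsionCount_of_dualImageCount`

Cell `bsd-print-cf2`, width seat `bsd-line-cf2-p1-w2` g11; `--supports stmt-BirchSwinnertonDyer-20368` (helper, Theses-free).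
HONEST FRAMING: nothing here closes a crux or a stub; BSD is not proved by any of this; no summit statement is proved by this seat.
No definition, no named fact, no `sorry`, no kit. beyond-print theorem: no (bookkeeping).

WHAT. -w4 g10's master-identity road displays (LF.1) as «`∃ t : ℤ → ℤ → ℕ`, for every frame (`d`, `W`, `C`, `K`, `v`, `v̄`), `∃ N₂`, for all
`N ≥ N₂`, `#ker(2^N • on ((W_K) ⊗ K_v)(K_v)) = 2 ^ t (d % 2) ((d / (2 − d % 2)) % 8)`» (STATUS 23:58:56Z). **`hLF1_holds`** is that statement with
`t i j := if i = 1 ∧ j = 3 then 3 else 2` and `N₂ := 3`, from p678984 `natCard_ker_nsmul_baseChange_adicCompletion_of_frame` (`= 8` for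
`d ≡ 3 (mod 8)`, `= 4` otherwise) and -w6 g3's key dictionary `key_eq_one_three_iff`.

References: J. H. Silverman, J. Tate, *Rational Points on Elliptic Curves* (2015) §3.5 [SilvermanTate2015]; J. H. Silverman, *AEC* (2009) VIII §1
[SilvermanAEC2009].
-/

noncomputable section

open scoped Classical

set_option linter.dupNamespace false -- `Summit.BirchSwinnertonDyer.BirchSwinnertonDyer` (summit = problem) is the tree's layout
set_option autoImplicit false

open NumberField IsDedekindDomain Field WeierstrassCurve
open Literature.NumberTheory.EllipticCurves

namespace Summit.BirchSwinnertonDyer.BirchSwinnertonDyer.Theorems.PrintCf2.LocalLineCount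

open Summit.BirchSwinnertonDyer.BirchSwinnertonDyer.Theorems.PrintCf2.RestrictedSelmerPair

/-- **(LF.1) HOLDS in the `∃ t` shape**: with `t i j := if i = 1 ∧ j = 3 then 3 else 2`, on every frame and for every `N ≥ 3`,
`#ker(2^N • on ((W_K) ⊗ K_v)(K_v)) = 2 ^ t (d % 2) ((d / (2 − d % 2)) % 8)` (`= 2^{2 + [d ≡ 3 (8)]}`). [cite: SilvermanTate2015, §3.5]
[cite: SilvermanAEC2009, VIII §1] -/
theorem hLF1_holds :
    ∃ t : ℤ → ℤ → ℕ, ∀ (d : ℤ), d ≠ 0 → Squarefree d → d % 4 ≠ 1 →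
      ∀ (W : WeierstrassCurve ℚ) [W.IsElliptic] [W.IsGloballyMinimal] (C : VariableChange ℚ),
        C • W = cm7.quadraticTwist (d : ℚ) →
      ∀ (K : Type) [Field K] [NumberField K], IsImaginaryQuadratic K →
      ∀ (v vbar : HeightOneSpectrum (𝓞 K)),
        ((2 : ℕ) : 𝓞 K) ∈ v.asIdeal → ((2 : ℕ) : 𝓞 K) ∈ vbar.asIdeal → vbar ≠ v →
      ∃ N₂ : ℕ, ∀ N : ℕ, N₂ ≤ N →
        Nat.card (nsmulAddMonoidHom (2 ^ N) :
            ((W.baseChange K).baseChange (v.adicCompletion K)).toAffine.Point →+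
              ((W.baseChange K).baseChange (v.adicCompletion K)).toAffine.Point).ker =
          2 ^ t (d % 2) ((d / (2 - d % 2)) % 8) := by
  refine ⟨fun i j ↦ if i = 1 ∧ j = 3 then 3 else 2, ?_⟩
  intro d _ hsq hd4 W _ _ C hC K _ _ hK v vbar hv hvbar hne
  refine ⟨3, fun N hN ↦ ?_⟩
  rw [natCard_ker_nsmul_baseChange_adicCompletion_of_frame hsq hd4 W hC hK hv hvbar hne hN]
  show (if d % 8 = 3 then 8 else 4) = 2 ^ (if d % 2 = 1 ∧ d / (2 - d % 2) % 8 = 3 then 3 else 2)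
  by_cases h3 : d % 8 = 3
  · rw [if_pos h3, if_pos ((key_eq_one_three_iff d).mpr h3)]; norm_num
  · rw [if_neg h3, if_neg (fun h ↦ h3 ((key_eq_one_three_iff d).mp h))]; norm_num

/-- The same with the WITNESS exposed (for consumers who fix `t`). -/
theorem natCard_ker_nsmul_eq_two_pow_key {d : ℤ} (hsq : Squarefree d) (hd4 : d % 4 ≠ 1)
    (W : WeierstrassCurve ℚ) [W.IsElliptic] {C : VariableChange ℚ} (hC : C • W = cm7.quadraticTwist (d : ℚ))
    {K : Type} [Field K] [NumberField K] (hK : IsImaginaryQuadratic K) {v vbar : HeightOneSpectrum (𝓞 K)}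
    (hv : ((2 : ℕ) : 𝓞 K) ∈ v.asIdeal) (hvbar : ((2 : ℕ) : 𝓞 K) ∈ vbar.asIdeal) (hne : vbar ≠ v) {N : ℕ} (hN : 3 ≤ N) :
    Nat.card (nsmulAddMonoidHom (2 ^ N) :
        ((W.baseChange K).baseChange (v.adicCompletion K)).toAffine.Point →+
          ((W.baseChange K).baseChange (v.adicCompletion K)).toAffine.Point).ker =
      2 ^ (if d % 2 = 1 ∧ d / (2 - d % 2) % 8 = 3 then 3 else 2) := by
  rw [natCard_ker_nsmul_baseChange_adicCompletion_of_frame hsq hd4 W hC hK hv hvbar hne hN]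
  by_cases h3 : d % 8 = 3
  · rw [if_pos h3, if_pos ((key_eq_one_three_iff d).mpr h3)]; norm_num
  · rw [if_neg h3, if_neg (fun h ↦ h3 ((key_eq_one_three_iff d).mp h))]; norm_num

end Summit.BirchSwinnertonDyer.BirchSwinnertonDyer.Theorems.PrintCf2.LocalLineCount

end
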